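import Mathlib
import HarnessLib
import HarnessLib.Audit
import Summits.AtomisticToContinuum.Statement
import Literature.MathematicalPhysics.KineticTheory.LangevinChainNESSHolds
import Summits.AtomisticToContinuum.FouriersLaw.Theorems.EmbeddedDrudeMourreNessUnique
import Summits.AtomisticToContinuum.FouriersLaw.Theorems.OddSectorIrreversibilityBoundedResponseConvergesStubPositiveConductance
import Summits.AtomisticToContinuum.FouriersLaw.Theorems.FourierGreenKuboFourierFiniteResponseOfUnique
import Summits.AtomisticToContinuum.FouriersLaw.Theses.PuiseuxTransferLedger
import Summits.AtomisticToContinuum.FouriersLaw.Theorems.JunctionLocalityNonBallisticOfZeroDrudeWeight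

/-!
# Split probe (crux-strategist s2, stmt-AtomisticToContinuum-9127): `NonBallistic` ← {`ExtensiveSnapshotIrreversibility`, `ZeroDrudeWeightInfiniteChain`}
on route `PuiseuxTransferLedger`, glued BY the landed theorem
`Summit.AtomisticToContinuum.FouriersLaw.Theorems.NonBallistic.nonBallistic_of_extensiveSnapshotIrreversibility_of_zeroDrudeWeight`.

This file mirrors what the gate renders for `ledger route edit route-AtomisticToContinuum-PuiseuxTransferLedger --split NonBallistic
--into children.json --glue-by …`: the two children as `def`s in the route namespace (texts = children.json verbatim) and
`theorem NonBallisticGlueBy_holds : Child₁ → Child₂ → NonBallistic := _root_.<glue-by>` — which must elaborate by δ-unfolding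
(`PuiseuxTransferLedger.NonBallistic` ≡ `JunctionLocality.NonBallistic`, child 1 ≡ `BondHeatUncertainty.ExtensiveSnapshotIrreversibility`
(= stmt-9121), child 2 ≡ the lead's registered stub `stub_zeroDrudeWeightInfiniteChain`). Import-cycle check: the glue module's closure
contains `Theses.JunctionLocality` / `Theses.BondHeatUncertainty` but NOT `Theses.PuiseuxTransferLedger`, so only this route can link it.
-/

namespace Summit.AtomisticToContinuum.FouriersLaw.Theses.PuiseuxTransferLedger
open scoped BigOperators Topology Manifold Classical MeasureTheory ProbabilityTheory Matrix InnerProductSpace ComplexConjugate ContinuousMap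
open Filter Set Function TopologicalSpace MeasureTheory

/-- child 1 (= stmt-AtomisticToContinuum-9121 verbatim). -/
def ExtensiveSnapshotIrreversibility : Prop :=
  ∀ ω₂ lam β γ : ℝ, 0 < ω₂ → 0 < lam → 0 < β → 0 < γ → (∀ (N : ℕ) (T_L T_R : ℝ), 0 < T_L → 0 < T_R → ∀ μ ν : MeasureTheory.Measure (Literature.MathematicalPhysics.KineticTheory.HeatConduction.PhaseSpace N), (Literature.MathematicalPhysics.KineticTheory.HeatConduction.pinnedChain ω₂ lam β γ).IsSteadyState N T_L T_R μ → (Literature.MathematicalPhysics.KineticTheory.HeatConduction.pinnedChain ω₂ lam β γ).IsSteadyState N T_L T_R ν → μ = ν) → ∀ μ : (N : ℕ) → ℝ → ℝ → MeasureTheory.Measure (Literature.MathematicalPhysics.KineticTheory.HeatConduction.PhaseSpace N), (∀ (N : ℕ) (T_L T_R : ℝ), 0 < T_L → 0 < T_R → (Literature.MathematicalPhysics.KineticTheory.HeatConduction.pinnedChain ω₂ lam β γ).IsSteadyState N T_L T_R (μ N T_L T_R)) → ∀ T : ℝ, 0 < T → ∃ C : ℝ, ∀ N : ℕ, ∀ᶠ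 δ in nhdsWithin (0 : ℝ) {(0 : ℝ)}ᶜ, InformationTheory.klDiv (μ N (T + δ / 2) (T - δ / 2)) (MeasureTheory.Measure.map (fun x : Literature.MathematicalPhysics.KineticTheory.HeatConduction.PhaseSpace N => (x.1, -x.2)) (μ N (T + δ / 2) (T - δ / 2))) ≤ ENNReal.ofReal (C * (N : ℝ) * δ ^ 2)

/-- child 2 (= the live stub `stub_zeroDrudeWeightInfiniteChain` verbatim, fully qualified; = consequent form of CTQ stmt-11032). -/
def ZeroDrudeWeightInfiniteChain : Prop :=
  ∀ ω₂ lam β γ : ℝ, 0 < ω₂ → 0 < lam → 0 < β → ∀ T : ℝ, 0 < T → ∀ μ : MeasureTheory.Measure Literature.MathematicalPhysics.KineticTheory.HeatConduction.ChainConfig, (Literature.MathematicalPhysics.KineticTheory.HeatConduction.pinnedChain ω₂ lam β γ).IsChainGibbsMeasure T μ → Literature.MathematicalPhysics.KineticTheory.HeatConduction.IsShiftInvariant μ → μ.map (fun σ : Literature.MathematicalPhysics.KineticTheory.HeatConduction.ChainConfig => fun x : ℤ => ((σ x).1, -(σ x).2)) = μ → ∀ D : Literature.MathematicalPhysics.KineticTheory.HeatConduction.InfiniteChainDynamics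 (Literature.MathematicalPhysics.KineticTheory.HeatConduction.pinnedChain ω₂ lam β γ), D.PreservesMeasure μ → (∀ t : ℝ, ∀ᵐ σ ∂μ, D.flow t (Literature.MathematicalPhysics.KineticTheory.HeatConduction.shift σ) = Literature.MathematicalPhysics.KineticTheory.HeatConduction.shift (D.flow t σ)) → (∀ t : ℝ, D.HasAbsConvergentCorrelation μ t) → Filter.Tendsto (fun τ : ℝ => τ⁻¹ * ∫ t in (0:ℝ)..τ, D.currentCorrelation μ t) Filter.atTop (nhds 0)

/-- What the gate renders for `--glue-by`. -/
theorem NonBallisticGlueBy_holds : ExtensiveSnapshotIrreversibility → ZeroDrudeWeightInfiniteChain → NonBallistic :=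
  _root_.Summit.AtomisticToContinuum.FouriersLaw.Theorems.NonBallistic.nonBallistic_of_extensiveSnapshotIrreversibility_of_zeroDrudeWeight

/-- Dedup check: child 1 IS `BondHeatUncertainty.ExtensiveSnapshotIrreversibility` (stmt-9121). -/
example : ExtensiveSnapshotIrreversibility ↔
    _root_.Summit.AtomisticToContinuum.FouriersLaw.Theses.BondHeatUncertainty.ExtensiveSnapshotIrreversibility := Iff.rfl

/-- The parent IS the shared decl (Disproof §8). -/
example : NonBallistic ↔ _root_.Summit.AtomisticToContinuum.FouriersLaw.Theses.JunctionLocality.NonBallistic := Iff.rfl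

/-- Supply line: child 2 ⟸ CurrentTiltQuench items 11032 ∧ 11030 (landed `zeroDrudeWeightInfiniteChain_of_currentTiltQuench`). -/
example (h32 : _root_.Summit.AtomisticToContinuum.FouriersLaw.Theses.CurrentTiltQuench.DrudeFromTruncation)
    (h30 : _root_.Summit.AtomisticToContinuum.FouriersLaw.Theses.CurrentTiltQuench.NoTruncatedDrude) :
    ZeroDrudeWeightInfiniteChain :=
  _root_.Summit.AtomisticToContinuum.FouriersLaw.Theorems.NonBallistic.zeroDrudeWeightInfiniteChain_of_currentTiltQuench h32 h30

/-- Non-vacuity of child 2's hypotheses: an admissible pair exists at every `T > 0` (landed WIT). -/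
example : ∀ ω₂ lam β γ : ℝ, 0 < ω₂ → 0 < lam → 0 < β → 0 < γ → ∀ T : ℝ, 0 < T →
    ∃ (μ : MeasureTheory.Measure Literature.MathematicalPhysics.KineticTheory.HeatConduction.ChainConfig)
      (D : Literature.MathematicalPhysics.KineticTheory.HeatConduction.InfiniteChainDynamics
        (Literature.MathematicalPhysics.KineticTheory.HeatConduction.pinnedChain ω₂ lam β γ)),
      (Literature.MathematicalPhysics.KineticTheory.HeatConduction.pinnedChain ω₂ lam β γ).IsChainGibbsMeasure T μ ∧
      Literature.MathematicalPhysics.KineticTheory.HeatConduction.IsShiftInvariant μ ∧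
      μ.map (fun σ : Literature.MathematicalPhysics.KineticTheory.HeatConduction.ChainConfig => fun x : ℤ => ((σ x).1, -(σ x).2)) = μ ∧
      D.carrier ⊆ (Literature.MathematicalPhysics.KineticTheory.HeatConduction.pinnedChain ω₂ lam β γ).bmGood ∧
      D.PreservesMeasure μ ∧
      (∀ t : ℝ, ∀ᵐ σ ∂μ, D.flow t (Literature.MathematicalPhysics.KineticTheory.HeatConduction.shift σ) =
        Literature.MathematicalPhysics.KineticTheory.HeatConduction.shift (D.flow t σ)) ∧
      (∀ t : ℝ, D.HasAbsConvergentCorrelation μ t) :=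
  _root_.Summit.AtomisticToContinuum.FouriersLaw.Theorems.NonBallistic.stub_infiniteVolumeWitness

#print axioms NonBallisticGlueBy_holds

/-! ## 3-way DEDUP variant (the twin s2 seat's family, PuiseuxTransferLedger edition): children = 9121, 11032, 11030 verbatim -/

/-- child 2' (= stmt-AtomisticToContinuum-11032 verbatim). -/
def DrudeFromTruncation : Prop :=
  ∀ ω₂ lam β γ : ℝ, 0 < ω₂ → 0 < lam → 0 < β → ∀ T : ℝ, 0 < T → ∀ μ : MeasureTheory.Measure Literature.MathematicalPhysics.KineticTheory.HeatConduction.ChainConfig, (Literature.MathematicalPhysics.KineticTheory.HeatConduction.pinnedChain ω₂ lam β γ).IsChainGibbsMeasure T μ → Literature.MathematicalPhysics.KineticTheory.HeatConduction.IsShiftInvariant μ → μ.map (fun σ : Literature.MathematicalPhysics.KineticTheory.HeatConduction.ChainConfig => fun x : ℤ => ((σ x).1, -(σ x).2)) = μ → ∀ D : Literature.MathematicalPhysics.KineticTheory.HeatConduction.InfiniteChainDynamics (Literature.MathematicalPhysics.KineticTheory.HeatConduction.pinnedChain ω₂ lam β γ), D.PreservesMeasure μ → (∀ t : ℝ, ∀ᵐ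 σ ∂μ, D.flow t (Literature.MathematicalPhysics.KineticTheory.HeatConduction.shift σ) = Literature.MathematicalPhysics.KineticTheory.HeatConduction.shift (D.flow t σ)) → (∀ t : ℝ, D.HasAbsConvergentCorrelation μ t) → (∀ M : ℝ, 0 < M → ∀ F : ℝ → ℝ, F = (fun u : ℝ => max (-M) (min M u)) → ∀ η : ℝ, 0 < η → ∃ τ₀ : ℝ, ∀ τ : ℝ, τ₀ ≤ τ → ∃ L₀ : ℕ, ∀ L : ℕ, L₀ ≤ L → ∀ G : Literature.MathematicalPhysics.KineticTheory.HeatConduction.ChainConfig → ℝ, G = (fun σ : Literature.MathematicalPhysics.KineticTheory.HeatConduction.ChainConfig => ∑ x ∈ Finset.Icc (-(L : ℤ)) (L : ℤ), F ((Literature.MathematicalPhysics.KineticTheory.HeatConduction.pinnedChain ω₂ lam β γ).bondCurrentZ σ x)) → |(τ⁻¹ * ∫ t in (0:ℝ)..τ, ((∫ σ, F ((Literature.MathematicalPhysics.KineticTheory.HeatConduction.pinnedChain ω₂ lam β γ).bondCurrentZ (D.flow t σ) 0) * G σ ∂μ) - (∫ σ, F ((Literature.MathematicalPhysics.KineticTheory.HeatConduction.pinnedChain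 ω₂ lam β γ).bondCurrentZ (D.flow t σ) 0) ∂μ) * (∫ σ, G σ ∂μ)))| ≤ η) → Filter.Tendsto (fun τ : ℝ => τ⁻¹ * ∫ t in (0:ℝ)..τ, D.currentCorrelation μ t) Filter.atTop (nhds 0)

/-- child 3' (= stmt-AtomisticToContinuum-11030 verbatim). -/
def NoTruncatedDrude : Prop :=
  ∀ ω₂ lam β γ : ℝ, 0 < ω₂ → 0 < lam → 0 < β → ∀ T : ℝ, 0 < T → ∀ μ : MeasureTheory.Measure Literature.MathematicalPhysics.KineticTheory.HeatConduction.ChainConfig, (Literature.MathematicalPhysics.KineticTheory.HeatConduction.pinnedChain ω₂ lam β γ).IsChainGibbsMeasure T μ → Literature.MathematicalPhysics.KineticTheory.HeatConduction.IsShiftInvariant μ → μ.map (fun σ : Literature.MathematicalPhysics.KineticTheory.HeatConduction.ChainConfig => fun x : ℤ => ((σ x).1, -(σ x).2)) = μ → ∀ D : Literature.MathematicalPhysics.KineticTheory.HeatConduction.InfiniteChainDynamics (Literature.MathematicalPhysics.KineticTheory.HeatConduction.pinnedChain ω₂ lam β γ), D.PreservesMeasure μ → (∀ t : ℝ, ∀ᵐ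 σ ∂μ, D.flow t (Literature.MathematicalPhysics.KineticTheory.HeatConduction.shift σ) = Literature.MathematicalPhysics.KineticTheory.HeatConduction.shift (D.flow t σ)) → ∀ M : ℝ, 0 < M → ∀ F : ℝ → ℝ, F = (fun u : ℝ => max (-M) (min M u)) → ∀ η : ℝ, 0 < η → ∃ τ₀ : ℝ, ∀ τ : ℝ, τ₀ ≤ τ → ∃ L₀ : ℕ, ∀ L : ℕ, L₀ ≤ L → ∀ G : Literature.MathematicalPhysics.KineticTheory.HeatConduction.ChainConfig → ℝ, G = (fun σ : Literature.MathematicalPhysics.KineticTheory.HeatConduction.ChainConfig => ∑ x ∈ Finset.Icc (-(L : ℤ)) (L : ℤ), F ((Literature.MathematicalPhysics.KineticTheory.HeatConduction.pinnedChain ω₂ lam β γ).bondCurrentZ σ x)) → |(τ⁻¹ * ∫ t in (0:ℝ)..τ, ((∫ σ, F ((Literature.MathematicalPhysics.KineticTheory.HeatConduction.pinnedChain ω₂ lam β γ).bondCurrentZ (D.flow t σ) 0) * G σ ∂μ) - (∫ σ, F ((Literature.MathematicalPhysics.KineticTheory.HeatConduction.pinnedChain ω₂ lam β γ).bondCurrentZ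 (D.flow t σ) 0) ∂μ) * (∫ σ, G σ ∂μ)))| ≤ η

/-- What the gate renders for the 3-way `--glue-by`. -/
theorem NonBallisticGlueBy3_holds :
    ExtensiveSnapshotIrreversibility → DrudeFromTruncation → NoTruncatedDrude → NonBallistic :=
  _root_.Summit.AtomisticToContinuum.FouriersLaw.Theorems.NonBallistic.nonBallistic_of_extensiveSnapshotIrreversibility_of_currentTiltQuench

example : DrudeFromTruncation ↔ _root_.Summit.AtomisticToContinuum.FouriersLaw.Theses.CurrentTiltQuench.DrudeFromTruncation := Iff.rfl
example : NoTruncatedDrude ↔ _root_.Summit.AtomisticToContinuum.FouriersLaw.Theses.CurrentTiltQuench.NoTruncatedDrude := Iff.rfl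

/-- The 2-way child is implied by the 3-way pair (and is what the crux actually consumes). -/
example : DrudeFromTruncation → NoTruncatedDrude → ZeroDrudeWeightInfiniteChain :=
  fun h32 h30 => _root_.Summit.AtomisticToContinuum.FouriersLaw.Theorems.NonBallistic.zeroDrudeWeightInfiniteChain_of_currentTiltQuench h32 h30

#print axioms NonBallisticGlueBy3_holds

end Summit.AtomisticToContinuum.FouriersLaw.Theses.PuiseuxTransferLedger
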